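import Literature.NumberTheory.PAdicHodge.BmaxPlusXiRootsNonvanishing
import Literature.NumberTheory.PAdicHodge.BmaxPlusOmegaPrimeSaturated
import Mathlib.Algebra.Order.Ring.GeomSum
import HarnessLib

/-!
# `φ(y) = ι(ξφ(c))·y` in `A_max` forces `p·y ∈ ⋂ₙ φⁿ(A_max) = ι(𝔸_inf)`

Topic `Literature/NumberTheory/PAdicHodge`; namespace `Literature.NumberTheory.PAdicHodge`. THEOREMS ONLY (no definition, no named
fact, no instance). The heart of the `t`-divisibility theorem (TDIV) on Colmez's `A_max = B_max⁺(F)` (`BmaxPlus`; `ι : 𝔸_inf → A_max`,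
`θ_m = θ∘φᵐ`, `ω = ξ·c` Fontaine's generator of `ker θ`, `ω̃ = ξ·φ(c)`). Let `y ∈ A_max` with **`φ(y) = ι(ω̃)·y`**. Then:

* `frobBmaxPlus_iterate_eq_of_frobBmaxPlus_eq`, `theta_frobBmaxPlus_iterate_eq_zero_of_frobBmaxPlus_eq` — `φᵐ(y) = ι(∏_{i<m} φⁱω̃)·y`
  and **`θ(φᵐ y) = 0` for all `m ≥ 1`**;
* ★ `exists_prod_xi_mul_eq_of_frobBmaxPlus_eq` — for every `n` and every `pⁿ`-th root `ϖ` of `p♭`: **`p·y ∈ ι(ξ_1 ξ_2 ⋯ ξ_n)·A_max`**,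
  `ξ_j = [ϖ^{p^{n−j}}] − p` (iterate the divisions of `BmaxPlusThetaFrobeniusIterate` along the points `θ∘φʲ`, `j = 1,…,n`, with the two
  multipliers `pʲ` and `[ϖ^{1/p}]⋯[ϖ^{1/pʲ}] = [ϖ]^{aⱼ}`, `aⱼ ≤ pʲ`; compare, and remove the excess `[p♭] = p·ω'` by the `ω'`-saturation);
* ★ `natCast_mul_mem_range_frobBmaxPlus_iterate` — **`p·y ∈ φⁿ(A_max)` for every `n`** (apply `φⁿ`: `φⁿ(ξ_j) = φ^{n−j}(ξ)`, and
  `φⁿ(y) = ι(∏φⁱξ · ∏φ^{i+1}c)·y` with `c` a unit);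
* ★★ `exists_eq_ainfToBmaxPlus_of_frobBmaxPlus_eq` — **`p·y = ι(a)` with `φ(a) = ω̃·a` in `𝔸_inf`** (`⋂ₙ φⁿ(A_max) = ι(𝔸_inf)`,
  `BmaxPlusFrobeniusImageInter`; `ι` injective).

Analytically: `y/β` (`β = [ε^{1/p}] − 1`) is a `φ`-invariant function with `φ^{−n}(y) = β_{n+1}·(y/β)` bounded on the disc for all `n`, hence
bounded on the whole open unit disc, i.e. in `𝔸_inf`. Brick B7 of the φ-road of line `kato_lever` (crux K★ `stmt-BirchSwinnertonDyer-22226`,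
memo `Cruxes/StarredOptimalManinUnitFiveSeven/Lines/kato-lever-K2-fontaine-lemma-g24.md`). Infrastructure only: BSD / K★ are not proved by this.

## References
* [Colmez1998Annals] P. Colmez, *Théorie d'Iwasawa des représentations de de Rham d'un corps local*, Ann. of Math. 148 (1998), §III.3
  (`x ∈ t·B_max⁺ ⇔ θ(φⁿx) = 0 ∀n`).
* [FontaineAsterisque223III] J.-M. Fontaine, *Le corps des périodes p-adiques*, Astérisque 223 (1994), Exp. III §5.3 (Th. 5.3.7).
-/

noncomputable section

open WittVector Field ValuativeRel Polynomial Finset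
open Literature.AlgebraicGeometry.Resolution

namespace Literature.NumberTheory.PAdicHodge

open Literature.NumberTheory.GaloisRepresentations
open Literature.NumberTheory.GaloisRepresentations.IsNonarchimedeanLocalField

variable {F : Type} [Field F] [ValuativeRel F] [TopologicalSpace F] [IsNonarchimedeanLocalField F]
  [CharZero F] {p : ℕ} [Fact p.Prime] [Fact (¬ IsUnit (p : integerC F))]
  [IsAdicComplete (Ideal.span {(p : integerC F)}) (integerC F)]

/-! ### `φᵐ(y)` and `θ(φᵐ y) = 0` -/

omit [CharZero F] [IsAdicComplete (Ideal.span {(p : integerC F)}) (integerC F)] in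
/-- `φⁿ(∏ f) = ∏ φⁿ(f)` on `𝔸_inf`. [cite: FontaineAsterisque223III, Exp. II §1.1] -/
theorem frobenius_iterate_prod (n : ℕ) (s : Finset ℕ) (f : ℕ → Ainf (p := p) F) :
    (WittVector.frobenius : Ainf (p := p) F →+* Ainf (p := p) F)^[n] (∏ i ∈ s, f i) =
      ∏ i ∈ s, (WittVector.frobenius : Ainf (p := p) F →+* Ainf (p := p) F)^[n] (f i) := by
  rw [← RingHom.coe_pow, map_prod]

set_option maxHeartbeats 1600000 in
omit [CharZero F] [IsAdicComplete (Ideal.span {(p : integerC F)}) (integerC F)] in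
/-- **`φᵐ(y) = ι(∏_{i<m} φⁱ ω̃)·y`** when `φ(y) = ι(ω̃)·y`. [cite: Colmez1998Annals, §III.3] -/
theorem frobBmaxPlus_iterate_eq_of_frobBmaxPlus_eq {ω' : Ainf (p := p) F} {y : BmaxPlus F p}
    (hy : frobBmaxPlus F p y = ainfToBmaxPlus F p ω' * y) (m : ℕ) :
    (frobBmaxPlus F p)^[m] y =
      ainfToBmaxPlus F p (∏ i ∈ range m, (WittVector.frobenius : Ainf (p := p) F →+* Ainf (p := p) F)^[i] ω') * y := by
  induction m with
  | zero => rw [Function.iterate_zero, id, prod_range_zero, map_one, one_mul]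
  | succ m ih =>
    have e : ∏ i ∈ range (m + 1), (WittVector.frobenius : Ainf (p := p) F →+* Ainf (p := p) F)^[i] ω' =
        WittVector.frobenius (∏ i ∈ range m, (WittVector.frobenius : Ainf (p := p) F →+* Ainf (p := p) F)^[i] ω') * ω' := by
      rw [prod_range_succ', Function.iterate_zero, id, map_prod]
      exact congrArg (· * ω') (prod_congr rfl fun i _ => Function.iterate_succ_apply' _ _ _)
    rw [Function.iterate_succ_apply', ih, map_mul, frobBmaxPlus_ainfToBmaxPlus, hy, e, map_mul]
    ring

/-- **`θ(φᵐ y) = 0` for all `m ≥ 1`** when `φ(y) = ι(ξ·d)·y` (the factor `i = 0` of `∏_{i<m} φⁱ(ξd)` is `ξd ∈ ker θ`).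
[cite: Colmez1998Annals, §III.3] -/
theorem theta_frobBmaxPlus_iterate_eq_zero_of_frobBmaxPlus_eq {d : Ainf (p := p) F} {y : BmaxPlus F p}
    (hy : frobBmaxPlus F p y = ainfToBmaxPlus F p (xi * d) * y) {m : ℕ} (hm : m ≠ 0) :
    thetaBmaxPlus F p ((frobBmaxPlus F p)^[m] y) = 0 := by
  obtain ⟨m, rfl⟩ := Nat.exists_eq_succ_of_ne_zero hm
  rw [frobBmaxPlus_iterate_eq_of_frobBmaxPlus_eq hy, map_mul, thetaBmaxPlus_ainfToBmaxPlus, prod_range_succ', Function.iterate_zero,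
    id, map_mul, map_mul, fontaineTheta_xi, zero_mul, mul_zero, zero_mul]

/-! ### Products of non-zero-divisors -/

omit [CharZero F] [IsAdicComplete (Ideal.span {(p : integerC F)}) (integerC F)] in
/-- A finite product of non-zero-divisors of `A_max` is a non-zero-divisor. [cite: Colmez1998Annals, §III.2] -/
theorem eq_zero_of_prod_mul_eq_zero {f : ℕ → BmaxPlus F p} (hf : ∀ i, ∀ z : BmaxPlus F p, f i * z = 0 → z = 0) (n : ℕ) :
    ∀ {z : BmaxPlus F p}, (∏ i ∈ range n, f i) * z = 0 → z = 0 := by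
  induction n with
  | zero => intro z hz; rwa [prod_range_zero, one_mul] at hz
  | succ n ih => intro z hz; rw [prod_range_succ, mul_assoc] at hz; exact hf n z (ih hz)

/-! ### The iteration along the points `θ∘φʲ`, `j = 1, …, n` -/

omit [CharZero F] [IsAdicComplete (Ideal.span {(p : integerC F)}) (integerC F)] in
/-- `(ϖ^{p^{n−j}})^{pʲ} = ϖ^{pⁿ}` for `j ≤ n`. [cite: Colmez1998Annals, §III.3] -/
theorem pow_pow_pow_eq {ϖ : PreTilt (integerC F) p} {n j : ℕ} (hj : j ≤ n) : (ϖ ^ p ^ (n - j)) ^ p ^ j = ϖ ^ p ^ n := by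
  rw [← pow_mul, ← pow_add, Nat.sub_add_cancel hj]

set_option maxHeartbeats 1600000 in
/-- **The iteration.** If `θ(φᵐ y) = 0` for all `m ≥ 1` and `ϖ^{pⁿ} = p♭`, then for every `k ≤ n` there are `h, H ∈ A_max` with
`ι(∏_{j≤k}[ϖ^{p^{n−j}}])·y = ι(∏_{j≤k} ξ_j)·h`, `pᵏ·y = ι(∏_{j≤k} ξ_j)·H` (`ξ_j = [ϖ^{p^{n−j}}] − p`, products over `1 ≤ j ≤ k`) and
`θ(φᵐ h) = θ(φᵐ H) = 0` for all `m > k` (each step is one sharp division of `BmaxPlusThetaFrobeniusIterate`; the vanishing is transported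
through `θ(φᵐ ξ_j) ≠ 0`, `m ≠ j`). [cite: Colmez1998Annals, §III.3] -/
theorem exists_iterate_division {y : BmaxPlus F p}
    (hy : ∀ m, m ≠ 0 → thetaBmaxPlus F p ((frobBmaxPlus F p)^[m] y) = 0) {n : ℕ} {ϖ : PreTilt (integerC F) p} (hϖ : ϖ ^ p ^ n = pFlat) :
    ∀ k, k ≤ n → ∃ h H : BmaxPlus F p,
      ainfToBmaxPlus F p (∏ i ∈ range k, teichmuller p (ϖ ^ p ^ (n - (i + 1)))) * y =
        ainfToBmaxPlus F p (∏ i ∈ range k, (teichmuller p (ϖ ^ p ^ (n - (i + 1))) - (p : Ainf (p := p) F))) * h ∧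
      (p : BmaxPlus F p) ^ k * y =
        ainfToBmaxPlus F p (∏ i ∈ range k, (teichmuller p (ϖ ^ p ^ (n - (i + 1))) - (p : Ainf (p := p) F))) * H ∧
      (∀ m, k < m → thetaBmaxPlus F p ((frobBmaxPlus F p)^[m] h) = 0) ∧
      (∀ m, k < m → thetaBmaxPlus F p ((frobBmaxPlus F p)^[m] H) = 0) := by
  intro k
  induction k with
  | zero =>
    intro _
    exact ⟨y, y, by rw [prod_range_zero, prod_range_zero, map_one], by rw [prod_range_zero, pow_zero, map_one],
      fun m hm => hy m (by omega), fun m hm => hy m (by omega)⟩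
  | succ k ih =>
    intro hk
    obtain ⟨h, H, hh, hH, hθh, hθH⟩ := ih (by omega)
    have hroot : (ϖ ^ p ^ (n - (k + 1))) ^ p ^ (k + 1) = pFlat := by rw [pow_pow_pow_eq hk, hϖ]
    obtain ⟨h', hh'⟩ := exists_teichmuller_mul_eq_of_theta_frobenius_iterate_eq_zero hroot (hθh (k + 1) (Nat.lt_succ_self k))
    obtain ⟨H', hH'⟩ := exists_natCast_mul_eq_of_theta_frobenius_iterate_eq_zero hroot (hθH (k + 1) (Nat.lt_succ_self k))
    have hne : ∀ m, k + 1 < m → thetaBmaxPlus F p ((frobBmaxPlus F p)^[m]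
        (ainfToBmaxPlus F p (teichmuller p (ϖ ^ p ^ (n - (k + 1))) - (p : Ainf (p := p) F)))) ≠ 0 := by
      intro m hm
      rw [thetaBmaxPlus_frobBmaxPlus_iterate_ainfToBmaxPlus]
      exact fontaineTheta_frobenius_iterate_xiM_ne_zero hroot (by omega)
    refine ⟨h', H', ?_, ?_, fun m hm => ?_, fun m hm => ?_⟩
    · rw [prod_range_succ, prod_range_succ, map_mul, map_mul]
      linear_combination (ainfToBmaxPlus F p (teichmuller p (ϖ ^ p ^ (n - (k + 1))))) * hh +
        (ainfToBmaxPlus F p (∏ i ∈ range k, (teichmuller p (ϖ ^ p ^ (n - (i + 1))) - (p : Ainf (p := p) F)))) * hh'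
    · rw [prod_range_succ, pow_succ, map_mul]
      linear_combination (p : BmaxPlus F p) * hH +
        (ainfToBmaxPlus F p (∏ i ∈ range k, (teichmuller p (ϖ ^ p ^ (n - (i + 1))) - (p : Ainf (p := p) F)))) * hH'
    · have e := congrArg (fun z => thetaBmaxPlus F p ((frobBmaxPlus F p)^[m] z)) hh'
      simp only [iterate_map_mul, map_mul, hθh m (by omega), mul_zero] at e
      exact (mul_eq_zero.1 e.symm).resolve_left (hne m hm)
    · have e := congrArg (fun z => thetaBmaxPlus F p ((frobBmaxPlus F p)^[m] z)) hH'
      simp only [iterate_map_mul, map_mul, hθH m (by omega), mul_zero, frobBmaxPlus_iterate_natCast, map_natCast] at e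
      exact (mul_eq_zero.1 e.symm).resolve_left (hne m hm)

/-! ### `p·y ∈ ι(ξ_1⋯ξ_n)·A_max` -/

omit [CharZero F] [IsAdicComplete (Ideal.span {(p : integerC F)}) (integerC F)] in
/-- `∏_{i<n} ϖ^{p^{n−1−i}} · ϖ^b = ϖ^{pⁿ}` for a suitable `b` (`Σ_{i<n} p^i < pⁿ`). [cite: Colmez1998Annals, §III.3] -/
theorem exists_prod_pow_mul_pow_eq (ϖ : PreTilt (integerC F) p) (n : ℕ) :
    ∃ b : ℕ, (∏ i ∈ range n, ϖ ^ p ^ (n - (i + 1))) * ϖ ^ b = ϖ ^ p ^ n := by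
  have hlt : ∑ i ∈ range n, p ^ (n - (i + 1)) < p ^ n := by
    have h := Nat.geomSum_lt (m := p) (s := range n) (n := n) (Nat.Prime.two_le Fact.out) (fun k hk => mem_range.1 hk)
    have e : ∑ i ∈ range n, p ^ (n - (i + 1)) = ∑ i ∈ range n, p ^ i := by
      rw [← sum_range_reflect (fun i => p ^ i) n]
      exact sum_congr rfl fun i _ => by rw [show n - (i + 1) = n - 1 - i by omega]
    rwa [e]
  refine ⟨p ^ n - ∑ i ∈ range n, p ^ (n - (i + 1)), ?_⟩
  rw [prod_pow_eq_pow_sum, ← pow_add, Nat.add_sub_cancel' hlt.le]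

set_option maxHeartbeats 1600000 in
/-- ★ **`p·y ∈ ι(ξ_1 ξ_2 ⋯ ξ_n)·A_max`** for `y` with `θ(φᵐ y) = 0` (`m ≥ 1`) and `ϖ^{pⁿ} = p♭`, `ξ_j = [ϖ^{p^{n−j}}] − p`: from the iteration,
`ι([ϖ]^a)·y = ι(Ξ)·h` and `pⁿ·y = ι(Ξ)·H`; `Ξ` is regular, so `ι([ϖ]^a)·H = pⁿ·h`, whence `p·ω'·H = ι([ϖ]^{pⁿ})·H ∈ pⁿA_max` and
`H ∈ p^{n−1}A_max` by the `ω'`-saturation. [cite: Colmez1998Annals, §III.3] -/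
theorem exists_natCast_mul_eq_prod_xi_mul (hF : Function.Surjective (fontaineTheta (integerC F) p)) {y : BmaxPlus F p}
    (hy : ∀ m, m ≠ 0 → thetaBmaxPlus F p ((frobBmaxPlus F p)^[m] y) = 0) {n : ℕ} (hn : n ≠ 0) {ϖ : PreTilt (integerC F) p}
    (hϖ : ϖ ^ p ^ n = pFlat) :
    ∃ H : BmaxPlus F p, (p : BmaxPlus F p) * y =
      ainfToBmaxPlus F p (∏ i ∈ range n, (teichmuller p (ϖ ^ p ^ (n - (i + 1))) - (p : Ainf (p := p) F))) * H := by
  obtain ⟨h, H, hh, hH, -, -⟩ := exists_iterate_division hy hϖ n le_rfl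
  set Ξ := ainfToBmaxPlus F p (∏ i ∈ range n, (teichmuller p (ϖ ^ p ^ (n - (i + 1))) - (p : Ainf (p := p) F))) with hΞ
  -- `Ξ` is a non-zero-divisor
  have hreg : ∀ z : BmaxPlus F p, Ξ * z = 0 → z = 0 := by
    intro z hz
    rw [hΞ, map_prod] at hz
    refine eq_zero_of_prod_mul_eq_zero (fun i w hw => ?_) n hz
    by_cases hi : i + 1 ≤ n
    · exact eq_zero_of_xiM_mul_eq_zero hF (j := i + 1) (by rw [pow_pow_pow_eq hi, hϖ]) (Nat.succ_ne_zero i) hw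
    · -- junk indices do not occur, but the factor is still regular: `n - (i+1) = 0`, `[ϖ] − p` with `ϖ^{pⁿ} = p♭`
      rw [show n - (i + 1) = 0 by omega, pow_zero, pow_one] at hw
      exact eq_zero_of_xiM_mul_eq_zero hF (j := n) hϖ hn hw
  -- `ι(Π)·H = pⁿ·h`
  have h1 : ainfToBmaxPlus F p (∏ i ∈ range n, teichmuller p (ϖ ^ p ^ (n - (i + 1)))) * H = (p : BmaxPlus F p) ^ n * h := by
    refine sub_eq_zero.1 (hreg _ ?_)
    linear_combination (-(ainfToBmaxPlus F p (∏ i ∈ range n, teichmuller p (ϖ ^ p ^ (n - (i + 1)))))) * hH +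
      (p : BmaxPlus F p) ^ n * hh
  -- `Π · ϖ^b = ϖ^{pⁿ}`, `ι[ϖ]^{pⁿ} = p·ω'`
  obtain ⟨b, hb⟩ := exists_prod_pow_mul_pow_eq ϖ n
  have e3 : ainfToBmaxPlus F p (∏ i ∈ range n, teichmuller p (ϖ ^ p ^ (n - (i + 1)))) * ainfToBmaxPlus F p (teichmuller p (ϖ ^ b)) =
      (p : BmaxPlus F p) * (algebraMap (bmaxZero F p) (BmaxPlus F p) omegaB + 1) := by
    rw [← map_mul, ← map_prod (teichmuller p : PreTilt (integerC F) p →* Ainf (p := p) F),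
      ← map_mul (teichmuller p : PreTilt (integerC F) p →* Ainf (p := p) F), hb, map_pow, map_pow, ainfToBmaxPlus_teichmuller_pow hϖ]
  have h2 : (p : BmaxPlus F p) * (algebraMap (bmaxZero F p) (BmaxPlus F p) omegaB + 1) * H =
      (p : BmaxPlus F p) ^ n * (ainfToBmaxPlus F p (teichmuller p (ϖ ^ b)) * h) := by
    calc (p : BmaxPlus F p) * (algebraMap (bmaxZero F p) (BmaxPlus F p) omegaB + 1) * H
        = ainfToBmaxPlus F p (teichmuller p (ϖ ^ b)) *
            (ainfToBmaxPlus F p (∏ i ∈ range n, teichmuller p (ϖ ^ p ^ (n - (i + 1)))) * H) := by rw [← e3]; ring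
      _ = (p : BmaxPlus F p) ^ n * (ainfToBmaxPlus F p (teichmuller p (ϖ ^ b)) * h) := by rw [h1]; ring
  -- cancel one `p` and saturate
  obtain ⟨n', rfl⟩ := Nat.exists_eq_succ_of_ne_zero hn
  have h3 : (algebraMap (bmaxZero F p) (BmaxPlus F p) omegaB + 1) * H =
      (p : BmaxPlus F p) ^ n' * (ainfToBmaxPlus F p (teichmuller p (ϖ ^ b)) * h) := by
    refine sub_eq_zero.1 (eq_zero_of_natCast_mul_eq_zero' hF ?_)
    rw [mul_sub, ← mul_assoc, h2, pow_succ]; ring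
  obtain ⟨H', hH'⟩ := exists_eq_natCast_pow_mul_of_omegaB_add_one_mul_eq h3
  refine ⟨H', sub_eq_zero.1 (eq_zero_of_natCast_pow_mul_eq_zero hF n' ?_)⟩
  rw [mul_sub, ← mul_assoc, ← pow_succ, hH, hH']
  ring

/-! ### `p·y ∈ φⁿ(A_max)` -/

omit [CharZero F] [IsAdicComplete (Ideal.span {(p : integerC F)}) (integerC F)] in
/-- **`φⁿ(ξ_j) = φ^{n−j}(ξ)`**: `φⁿ([ϖ^{p^{n−j}}] − p) = [p♭]^{p^{n−j}} − p` for `ϖ^{pⁿ} = p♭`. [cite: Colmez1998Annals, §III.3] -/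
theorem frobenius_iterate_xiRoot {n : ℕ} {ϖ : PreTilt (integerC F) p} (hϖ : ϖ ^ p ^ n = pFlat) (i : ℕ) :
    (WittVector.frobenius : Ainf (p := p) F →+* Ainf (p := p) F)^[n] (teichmuller p (ϖ ^ p ^ (n - (i + 1))) - (p : Ainf (p := p) F)) =
      (WittVector.frobenius : Ainf (p := p) F →+* Ainf (p := p) F)^[n - (i + 1)] xi := by
  rw [iterate_map_sub, frobenius_iterate_teichmuller, frobenius_iterate_natCast, xi_def, iterate_map_sub, frobenius_iterate_teichmuller,
    frobenius_iterate_natCast, ← map_pow, ← map_pow, ← pow_mul, mul_comm, pow_mul, hϖ]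

set_option maxHeartbeats 1600000 in
/-- ★ **`p·y ∈ φⁿ(A_max)` for every `n`**, for `y ∈ A_max` with `φ(y) = ι(ξφ(c))·y`, `ω = ξ·c`: apply `φⁿ` to `p·y = ι(Ξ)·H`; since
`φⁿ(Ξ) = ∏_{i<n} φⁱ(ξ)` is regular and `φⁿ(y) = ι(∏φⁱξ · ∏φ^{i+1}c)·y` with `c` a unit, `p·y = ι((∏φ^{i+1}c)⁻¹)·φⁿ(H) ∈ φⁿ(A_max)`.
[cite: Colmez1998Annals, §III.3] -/
theorem natCast_mul_mem_range_frobBmaxPlus_iterate (hF : Function.Surjective (fontaineTheta (integerC F) p)) {c : Ainf (p := p) F}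
    (hc : omega = xi * c) {y : BmaxPlus F p} (hy : frobBmaxPlus F p y = ainfToBmaxPlus F p (xi * WittVector.frobenius c) * y) (n : ℕ) :
    ∃ G : BmaxPlus F p, (p : BmaxPlus F p) * y = (frobBmaxPlus F p)^[n] G := by
  rcases Nat.eq_zero_or_pos n with rfl | hn
  · exact ⟨(p : BmaxPlus F p) * y, rfl⟩
  -- a `pⁿ`-th root of `p♭`
  set ϖ : PreTilt (integerC F) p := ((frobeniusEquiv (PreTilt (integerC F) p) p).symm^[n]) pFlat with hϖdef
  have hϖ : ϖ ^ p ^ n = pFlat := by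
    have key : ∀ k (x : PreTilt (integerC F) p), (((frobeniusEquiv (PreTilt (integerC F) p) p).symm^[k]) x) ^ p ^ k = x := by
      intro k
      induction k with
      | zero => intro x; rw [Function.iterate_zero, id, pow_zero, pow_one]
      | succ k ih =>
        intro x
        rw [Function.iterate_succ_apply, pow_succ, pow_mul, ih, ← frobenius_def, frobenius_apply_frobeniusEquiv_symm]
    exact key n pFlat
  have hθ : ∀ m, m ≠ 0 → thetaBmaxPlus F p ((frobBmaxPlus F p)^[m] y) = 0 :=
    fun m hm => theta_frobBmaxPlus_iterate_eq_zero_of_frobBmaxPlus_eq hy hm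
  obtain ⟨H, hH⟩ := exists_natCast_mul_eq_prod_xi_mul hF hθ hn.ne' hϖ
  -- apply `φⁿ`
  have e1 := congrArg (fun z => (frobBmaxPlus F p)^[n] z) hH
  simp only [iterate_map_mul, frobBmaxPlus_iterate_natCast, frobBmaxPlus_iterate_eq_of_frobBmaxPlus_eq hy,
    frobBmaxPlus_iterate_ainfToBmaxPlus, frobenius_iterate_prod, frobenius_iterate_xiRoot hϖ] at e1
  -- `e1 : p * (ι(∏ φⁱξ · φⁱ(φc)) * y) = ι(∏ φ^{n-(i+1)} ξ) * φⁿ H`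
  set P : Ainf (p := p) F := ∏ i ∈ range n, (WittVector.frobenius : Ainf (p := p) F →+* Ainf (p := p) F)^[i] xi with hP
  set E : Ainf (p := p) F := ∏ i ∈ range n, (WittVector.frobenius : Ainf (p := p) F →+* Ainf (p := p) F)^[i] (WittVector.frobenius c)
    with hE
  have hPE : ∏ i ∈ range n, ((WittVector.frobenius : Ainf (p := p) F →+* Ainf (p := p) F)^[i] xi *
      (WittVector.frobenius : Ainf (p := p) F →+* Ainf (p := p) F)^[i] (WittVector.frobenius c)) = P * E := by
    rw [hP, hE, ← prod_mul_distrib]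
  have hrefl : ∏ i ∈ range n, (WittVector.frobenius : Ainf (p := p) F →+* Ainf (p := p) F)^[n - (i + 1)] xi = P := by
    rw [hP, ← prod_range_reflect (fun i => (WittVector.frobenius : Ainf (p := p) F →+* Ainf (p := p) F)^[i] xi) n]
    exact prod_congr rfl fun i _ => by rw [show n - (i + 1) = n - 1 - i by omega]
  rw [hPE, hrefl, map_mul] at e1
  -- `ι(P)` is regular
  have hPreg : ∀ z : BmaxPlus F p, ainfToBmaxPlus F p P * z = 0 → z = 0 := by
    intro z hz
    rw [hP, map_prod] at hz
    refine eq_zero_of_prod_mul_eq_zero (fun i w hw => ?_) n hz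
    rcases Nat.eq_zero_or_pos i with rfl | hi
    · rw [Function.iterate_zero, id] at hw; exact eq_zero_of_xi_mul_eq_zero hF hw
    · exact eq_zero_of_frobenius_iterate_xi_mul_eq_zero hF hi.ne' hw
  have e2 : (p : BmaxPlus F p) * ainfToBmaxPlus F p E * y = (frobBmaxPlus F p)^[n] H := by
    refine sub_eq_zero.1 (hPreg _ ?_)
    rw [mul_sub]
    linear_combination e1
  -- `E` is a unit; write its inverse as `φⁿ(e)`
  have hEu : IsUnit E := by
    rw [hE, IsUnit.prod_iff]
    intro i _
    rw [← RingHom.coe_pow]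
    exact ((isUnit_of_omega_eq_xi_mul hc).map _).map _
  obtain ⟨Einv, hEinv⟩ := hEu.exists_left_inv
  obtain ⟨e, he⟩ := (WittVector.frobenius_bijective p (PreTilt (integerC F) p)).surjective.iterate n Einv
  refine ⟨ainfToBmaxPlus F p e * H, ?_⟩
  rw [iterate_map_mul, frobBmaxPlus_iterate_ainfToBmaxPlus, he, ← e2]
  calc (p : BmaxPlus F p) * y = ainfToBmaxPlus F p (Einv * E) * ((p : BmaxPlus F p) * y) := by rw [hEinv, map_one, one_mul]
    _ = ainfToBmaxPlus F p Einv * ((p : BmaxPlus F p) * ainfToBmaxPlus F p E * y) := by rw [map_mul]; ring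

/-! ### `p·y ∈ ι(𝔸_inf)` -/

/-- ★★ **`p·y = ι(a)` with `φ(a) = ξφ(c)·a`**, for `y ∈ A_max` with `φ(y) = ι(ξφ(c))·y` and `ω = ξ·c`: `p·y ∈ ⋂ₙ φⁿ(A_max) = ι(𝔸_inf)`
(`BmaxPlusFrobeniusImageInter`), and the `φ`-equation descends along the injective `ι`. [cite: Colmez1998Annals, §III.3]
[cite: FontaineAsterisque223III, Exp. III Th. 5.3.7] -/
theorem exists_eq_ainfToBmaxPlus_of_frobBmaxPlus_eq (hF : Function.Surjective (fontaineTheta (integerC F) p)) {c : Ainf (p := p) F}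
    (hc : omega = xi * c) {y : BmaxPlus F p} (hy : frobBmaxPlus F p y = ainfToBmaxPlus F p (xi * WittVector.frobenius c) * y) :
    ∃ a : Ainf (p := p) F, (p : BmaxPlus F p) * y = ainfToBmaxPlus F p a ∧
      WittVector.frobenius a = xi * WittVector.frobenius c * a := by
  obtain ⟨a, ha⟩ := exists_eq_ainfToBmaxPlus_of_forall_mem_range_frobBmaxPlus_iterate hF
    (natCast_mul_mem_range_frobBmaxPlus_iterate hF hc hy)
  refine ⟨a, ha, ainfToBmaxPlus_injective hF ?_⟩
  calc ainfToBmaxPlus F p (WittVector.frobenius a) = frobBmaxPlus F p (ainfToBmaxPlus F p a) := (frobBmaxPlus_ainfToBmaxPlus a).symm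
    _ = frobBmaxPlus F p ((p : BmaxPlus F p) * y) := by rw [ha]
    _ = ainfToBmaxPlus F p (xi * WittVector.frobenius c) * ((p : BmaxPlus F p) * y) := by rw [map_mul, map_natCast, hy]; ring
    _ = ainfToBmaxPlus F p (xi * WittVector.frobenius c * a) := by rw [ha, ← map_mul]

end Literature.NumberTheory.PAdicHodge

end
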